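import Mathlib.MeasureTheory.Integral.Bochner.Basic
import Mathlib.Data.ZMod.ValMinAbs
import Mathlib.Logic.Function.DependsOn
import Literature.Probability.LatticeModels.GibbsSpecification
import HarnessLib

/-!
# Coarse cells on a discrete torus: finite-size mixing conditions for specifications

Vocabulary for Dobrushin–Shlosman-type FINITE-SIZE CRITERIA run on a coarse torus of CELLS
(`∏ᵢ ℤ/(μᵢ+1)`), for a specification `γ` (Georgii) on a configuration space `V → S` whose sites /
links are labelled by cells through an arbitrary map `cell : V → CoarseIdx μ`:

* `CoarseIdx μ`, `cdist` (the `ℓ^∞` cyclic distance), `shellCount d n` (cells in the shell of the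
  cube of `(4n+1)^d` cells), `cellCount` (cells met by a finite set);
* `IsGoodFS cell γ good n ε` — the GOOD-EXTERIOR finite-size condition in total variation at window
  `n` and threshold `ε`: exterior data that agree on the cube of `(4n+1)^d` cells around `c` and are
  `good` on the cube-and-shell cells outside the resampled cell-union `A` give central-cell kernel
  expectations of `[0,1]`-valued cell-local observables within `ε` (with `good ≡ univ` this is the
  worst-case condition `C_V` of Dobrushin–Shlosman (1985), in the total-variation form);
* `HasLeak cell γ n Λl r` — a quasi-locality (leak) profile for non-Markov specifications;
* `IsLocallyAC cell γ γ₀ ε₁` — local absolute continuity of a perturbed specification w.r.t. a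
  reference one at rate `ε₁` per cell (two-sided, same exterior);
* `PeierlsRare good ν p` — Peierls rarity of bad cells under a measure.

These are DEFINITIONS only (plus elementary facts on `cdist`); the mixing theorems built on them
(disagreement percolation with rare open defects, van den Berg–Maes 1994) live in companion files.
Sources: R. L. Dobrushin, S. B. Shlosman, *Constructive criterion for the uniqueness of Gibbs
field* (1985), §2 (finite-size conditions `C_V`); J. van den Berg, C. Maes, Ann. Probab. 22 (1994)
(disagreement percolation); H.-O. Georgii, *Gibbs Measures and Phase Transitions* (2011), Ch. 8.
-/

open MeasureTheory

namespace Literature.Probability.LatticeModels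

/-! ### The coarse torus of cells -/

/-- **Coarse cell labels**: the discrete `d`-torus `∏ᵢ ℤ/(μᵢ+1)` (every axis has `μᵢ + 1 ≥ 1`
cells). [cite: DobrushinShlosman1985, §2] -/
abbrev CoarseIdx {d : ℕ} (μ : Fin d → ℕ) : Type := (i : Fin d) → ZMod (μ i + 1)

variable {d : ℕ} {μ : Fin d → ℕ}

/-- The `ℓ^∞` cyclic distance on the coarse torus (`valMinAbs` = signed representative of least
absolute value). [folklore] -/
def cdist (x y : CoarseIdx μ) : ℕ :=
  Finset.univ.sup fun i : Fin d => ((x i - y i).valMinAbs).natAbs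

/-- `cdist x x = 0`. [folklore] -/
@[simp] theorem cdist_self (x : CoarseIdx μ) : cdist x x = 0 := by
  simp [cdist]

/-- `(4n+3)^d − (4n+1)^d`: the number of SHELL cells around the cube of `(4n+1)^d` cells.
[cite: DobrushinShlosman1985, §2] -/
def shellCount (d n : ℕ) : ℕ := (4 * n + 3) ^ d - (4 * n + 1) ^ d

/-- The number of cells met by the finite set `A` of sites / links. [folklore] -/
def cellCount {V : Type*} [Fintype V] (cell : V → CoarseIdx μ) (A : Finset V) : ℕ :=
  (Finset.univ.filter fun c : CoarseIdx μ => ∃ v ∈ A, cell v = c).card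

/-! ### Finite-size conditions for a specification read through cells -/

variable {V S : Type*} [MeasurableSpace S]

/-- **Good-exterior finite-size condition in total variation** at window `n` and threshold `ε`:
`good c` is a cell-local measurable set of configurations, and for every cell-union `A` inside the
cube of `(4n+1)^d` cells centred at `c`, every two exterior data that AGREE on the cube and are GOOD
on the cube-and-shell cells outside `A`, and every `[0,1]`-valued measurable observable `f` of the
central cell, the kernel expectations `γ_A(f | ζ)`, `γ_A(f | ζ')` differ by at most `ε`. With
`good ≡ univ` this is the worst-case total-variation finite-size condition of Dobrushin–Shlosman.
[cite: DobrushinShlosman1985, §2] -/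
structure IsGoodFS [Fintype V] (cell : V → CoarseIdx μ) (γ : Specification V S)
    (good : CoarseIdx μ → Set (V → S)) (n : ℕ) (ε : ℝ) : Prop where
  good_local : ∀ (c : CoarseIdx μ) (σ τ : V → S), (∀ v, cell v = c → σ v = τ v) →
    (σ ∈ good c ↔ τ ∈ good c)
  good_meas : ∀ c, MeasurableSet (good c)
  fs : ∀ (c : CoarseIdx μ) (A : Finset V), (∀ v ∈ A, cdist c (cell v) ≤ 2 * n) →
    (∀ v w, cell v = cell w → v ∈ A → w ∈ A) →
    ∀ ζ ζ' : V → S, (∀ v, cdist c (cell v) ≤ 2 * n → ζ v = ζ' v) →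
      (∀ c', cdist c c' ≤ 2 * n + 1 → (∀ v, cell v = c' → v ∉ A) → ζ ∈ good c' ∧ ζ' ∈ good c') →
      ∀ f : (V → S) → ℝ, Measurable f → (∀ σ, 0 ≤ f σ ∧ f σ ≤ 1) → DependsOn f {v | cell v = c} →
        |∫ σ, f σ ∂(γ A ζ) - ∫ σ, f σ ∂(γ A ζ')| ≤ ε

/-- **Quasi-locality (leak) profile** of a specification at window `n`: exterior changes at cell
distance `> 2n+1+D` from the centre move central-cell expectations of cube kernels by at most
`Λl e^{-rD}` (a cell-scale Markov specification has `Λl = 0`). [folklore] -/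
def HasLeak [Fintype V] (cell : V → CoarseIdx μ) (γ : Specification V S) (n : ℕ) (Λl r : ℝ) : Prop :=
  ∀ (c : CoarseIdx μ) (A : Finset V), (∀ v ∈ A, cdist c (cell v) ≤ 2 * n) →
    (∀ v w, cell v = cell w → v ∈ A → w ∈ A) →
    ∀ (D : ℕ) (ζ ζ' : V → S), (∀ v, cdist c (cell v) ≤ 2 * n + 1 + D → ζ v = ζ' v) →
      ∀ f : (V → S) → ℝ, Measurable f → (∀ σ, 0 ≤ f σ ∧ f σ ≤ 1) → DependsOn f {v | cell v = c} →
        |∫ σ, f σ ∂(γ A ζ) - ∫ σ, f σ ∂(γ A ζ')| ≤ Λl * Real.exp (-(r * D))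

/-- **Local absolute continuity of `γ` with respect to `γ₀` at rate `ε₁` per cell**: on every
cell-union `A`, with the same exterior, kernel expectations of `[0,1]`-valued measurable functions
agree up to the factor `exp(ε₁ · #cells(A))`, both ways (bounded relative densities of the
finite-volume kernels, as for a bounded perturbation of the interaction). [cite: Georgii2011, Ch. 8] -/
def IsLocallyAC [Fintype V] (cell : V → CoarseIdx μ) (γ γ₀ : Specification V S) (ε₁ : ℝ) : Prop :=
  ∀ (A : Finset V), (∀ v w, cell v = cell w → v ∈ A → w ∈ A) → ∀ (ζ : V → S) (f : (V → S) → ℝ),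
    Measurable f → (∀ σ, 0 ≤ f σ ∧ f σ ≤ 1) →
      ∫ σ, f σ ∂(γ A ζ) ≤ Real.exp (ε₁ * cellCount cell A) * ∫ σ, f σ ∂(γ₀ A ζ) ∧
      ∫ σ, f σ ∂(γ₀ A ζ) ≤ Real.exp (ε₁ * cellCount cell A) * ∫ σ, f σ ∂(γ A ζ)

omit [MeasurableSpace S] in
/-- **Peierls rarity of bad cells** under the measure `ν`: `ν(all cells of D are bad) ≤ p^{|D|}` for
every finite set `D` of cells. [folklore] -/
def PeierlsRare [MeasurableSpace (V → S)] (good : CoarseIdx μ → Set (V → S)) (ν : Measure (V → S))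
    (p : ℝ) : Prop :=
  ∀ D : Finset (CoarseIdx μ), ν {σ | ∀ c ∈ D, σ ∉ good c} ≤ ENNReal.ofReal (p ^ D.card)

end Literature.Probability.LatticeModels
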